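import Literature.AlgebraicGeometry.Frobenioids.PadicFrobenioidRelCosetBase
import Literature.AnabelianGeometry.SemiGraphs.RelCosetCategoriesGaloisBase
import HarnessLib

/-!
# [FrdII] Ex. 1.3 (iii): the Datum-compatible base `PadicFrd.relBase` IS print's functor `D → D₀` followed by the
# Galois correspondence (small vs big models, by name)

Mochizuki, *The geometry of Frobenioids II*, Kyushu J. Math. **62** (2008), §1 Example 1.3 (iii), author's text p. 12
[cite: MochizukiFrdII2008, Ex 1.3 (iii) pp.11-12]: "when `F = ℚ_p`, if we set `D := 𝓑^temp(Π, Π°)⁰`, then we obtain a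
functor `D → D₀ = 𝓑^temp(G_{ℚ_p})⁰` [cf. Example 1.1, (ii)] which satisfies the hypotheses of Theorem 1.2, (i)."

PROOF-LEVEL COMPARISON (one natural isomorphism and its §2 form; no new notions). abc-iut-L1-t4's
`PadicFrobenioidRelCosetBase.lean` defines the base functor of `p`-adic Frobenioid data over the SMALL model
`RelCosetCat Π°` as the composite of small-model arrows `incl ⋙ CosetCat.push φ ⋙ CosetCat.pull π` with the base functor of
`D₀` (`CosetCat.toConnected ⋙ QuasiTemperoid.galoisPadicFields p`). The tree's witness of the PRINTED functor on the big
models is `QuasiTemperoid.galoisBaseFunctor ℚ_[p] Π Π° Q φ π` (named fact `GaloisBaseFunctor`, abc-iut-L1-t4). Whiskering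
`RelCosetCat.galoisBaseFunctorIso` (`RelCosetCategoriesGaloisBase.lean`) with `galoisPadicFields p`:

* `PadicFrd.relBaseIso : relBase p Π° φ hφ π hc hs ≅ RelCosetCat.toRelConnected _ ⋙ galoisBaseFunctor ℚ_[p] Π Π° Q φ π hφ hc hs
  ⋙ galoisPadicFields p` — the Datum base IS print's `D → D₀` followed by `D₀ → (finite extensions of ℚ_p)`, along the
  equivalence `RelCosetCat Π° ≌ ConnectedPart (BTempRel Π Π°)`;
* `PadicFrd.relBaseGalIso` — the §2 form (`G_{ℚ_p} ⥲ Q`, no pull-back): `relBaseGal ≅ toRelConnected ⋙ relInclusion ⋙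
  inductionFunctorConnected φ ⋙ galoisPadicFields p`.
Consequently every value of print's composite is a finite extension of `ℚ_p` with THE `p`-adic valuation
(`isPadicLocal_galoisBaseFunctor_obj`). Nothing of [FrdII] is re-typed; no statement is strengthened; nothing here bears
on [IUTchIII].
-/

namespace Literature.AlgebraicGeometry.Frobenioids

namespace PadicFrd

open CategoryTheory Literature.AnabelianGeometry.SemiGraphs

variable (p : ℕ) [Fact p.Prime]
variable {P : Type} [Group P] [TopologicalSpace P] [IsTopologicalGroup P] (hP : IsTempered P) (P₀ : OpenSubgroup P)
  {Q : Type} [Group Q] [TopologicalSpace Q] [IsTopologicalGroup Q] (hQ : IsTempered Q)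
  (φ : P →* Q) (hφ : QuasiTemperoid.IsOpenHom φ)
  (π : QuasiTemperoid.GalFbar ℚ_[p] →* Q) (hc : Continuous π) (hs : Function.Surjective π)

/-- **`relBase` IS print's Ex. 1.3 (iii) functor followed by the Galois correspondence** (small vs big models):
`relBase p Π° φ π ≅ toRelConnected ⋙ galoisBaseFunctor ℚ_[p] Π Π° Q φ π ⋙ galoisPadicFields p`, by whiskering
abc-iut-L1-t4's `RelCosetCat.galoisBaseFunctorIso` with `galoisPadicFields p` (all re-associations definitional).
[cite: MochizukiFrdII2008, Ex 1.3 (iii) pp.11-12] -/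
noncomputable def relBaseIso :
    relBase p P₀ φ hφ π hc hs ≅
      RelCosetCat.toRelConnected (H := P₀) hP ⋙
        QuasiTemperoid.galoisBaseFunctor ℚ_[p] P P₀.toSubgroup Q φ π hφ hc hs ⋙ QuasiTemperoid.galoisPadicFields p :=
  (Functor.isoWhiskerRight
    (RelCosetCat.galoisBaseFunctorIso hP P₀ hQ ℚ_[p] (QuasiTemperoid.isTempered_galFbar ℚ_[p]) φ hφ π hc hs)
    (QuasiTemperoid.galoisPadicFields p)).symm

include hQ in
/-- The same as a proposition. [cite: MochizukiFrdII2008, Ex 1.3 (iii) pp.11-12] -/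
theorem nonempty_relBaseIso :
    Nonempty (relBase p P₀ φ hφ π hc hs ≅
      RelCosetCat.toRelConnected (H := P₀) hP ⋙
        QuasiTemperoid.galoisBaseFunctor ℚ_[p] P P₀.toSubgroup Q φ π hφ hc hs ⋙ QuasiTemperoid.galoisPadicFields p) :=
  ⟨relBaseIso p hP P₀ hQ φ hφ π hc hs⟩

/-- Consequently every value of PRINT's composite `D → D₀ → (fields)` at an object `Π/U` of the small model is a finite
extension of `ℚ_p` with THE `p`-adic valuation (transport of `relBase_isPadicLocal` is not even needed:
`isPadicLocal_galoisPadicFields` applies to any object of `𝓑^temp(G_{ℚ_p})⁰`). [cite: MochizukiFrdII2008, Ex 1.3 (iii) pp.11-12] -/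
theorem isPadicLocal_galoisBaseFunctor_obj (X : RelCosetCat P₀) :
    ((RelCosetCat.toRelConnected (H := P₀) hP ⋙
        QuasiTemperoid.galoisBaseFunctor ℚ_[p] P P₀.toSubgroup Q φ π hφ hc hs ⋙
          QuasiTemperoid.galoisPadicFields p).obj X).IsPadicLocal :=
  QuasiTemperoid.isPadicLocal_galoisPadicFields p _

/-- **§2 form** (`G_{ℚ_p} ⥲ Q`): `relBaseGal p Π° φ ≅ toRelConnected ⋙ relInclusion ⋙ inductionFunctorConnected φ ⋙
galoisPadicFields p` (whiskering `RelCosetCat.inductionIso`). [cite: MochizukiFrdII2008, Def 2.2 p.17] -/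
noncomputable def relBaseGalIso (φ₀ : P →* QuasiTemperoid.GalFbar ℚ_[p]) (hφ₀ : QuasiTemperoid.IsOpenHom φ₀) :
    relBaseGal p P₀ φ₀ hφ₀ ≅
      RelCosetCat.toRelConnected (H := P₀) hP ⋙ QuasiTemperoid.relInclusion P P₀.toSubgroup ⋙
        QuasiTemperoid.inductionFunctorConnected φ₀ hφ₀.isOpenMap
          (QuasiTemperoid.countable_quotient_of_absoluteGaloisGroup ℚ_[p] (MonoidHom.id _) continuous_id
            Function.surjective_id) ⋙
          QuasiTemperoid.galoisPadicFields p :=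
  (Functor.isoWhiskerRight
    (RelCosetCat.inductionIso hP P₀ (QuasiTemperoid.isTempered_galFbar ℚ_[p]) φ₀ hφ₀
      (QuasiTemperoid.countable_quotient_of_absoluteGaloisGroup ℚ_[p] (MonoidHom.id _) continuous_id
        Function.surjective_id))
    (QuasiTemperoid.galoisPadicFields p)).symm

end PadicFrd

end Literature.AlgebraicGeometry.Frobenioids
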